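import Literature.NumberTheory.GaloisRepresentations.ContinuousH1
import Literature.NumberTheory.GaloisRepresentations.CyclotomicLevels
import Literature.NumberTheory.GaloisRepresentations.GaloisCohomology
import Mathlib.RepresentationTheory.Homological.GroupCohomology.LowDegree
import Mathlib.Topology.LocallyConstant.Basic
import HarnessLib

/-!
# Inflation–restriction in degree one for continuous cocycles: Sah's lemma modulo a vanishing
# subgroup, the finite-quotient bridge to group cohomology, and the (H.3) shape of Sakamoto 2024
# (cell `b2b-bsdres`, team n1011, seat p04 gen 3, OWNERS row T-B2 = skel/T-a3-F1-N11.md §3 (B2); file 1/2)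

HONEST FRAMING (cell `b2b-bsdres`, run/shared/lean/b2b/bsd-rank1-residual/, verbatim in every
file): the goal of the cell is to DELETE the COMBINATION-SHAPED residual classes of the
Birch–Swinnerton-Dyer formula for ALL analytic-rank `≤ 1` elliptic curves over `ℚ` — "full BSD
formula for every rank `≤ 1` curve in class `C`" assembled STRICTLY from published theorems — so
that the rank-`≤ 1` remainder becomes exactly the CONSTRUCTION-SHAPED classes, which are TYPED
(missing-input `Prop`s), NOT attempted. This is not "finishing BSD". Team n1011 (N10 / N11, the
additive block X4 ∧ `p = 3`): research route on the CONSTRUCTION-SHAPED class X4; no claim beyond the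
stated classes; nothing is booked. Theorems only (no definition, no named fact, no `sorry`);
pure group / Galois cohomology, nothing specific to elliptic curves.

## Why (row T-a3-F1, the N11 instance of Sakamoto 2024 Thm. 4.4 (1))

The tree's named fact `Literature.…Sakamoto2024.kolyvaginSystems_freeRankOne_zmod_three_pow`
(p254540) carries hypothesis (H.3) of Sakamoto, JTNB 36 (2024) §2 in the inflation–restriction form
"every CONTINUOUS crossed homomorphism `Γ_ℚ → T̄` vanishing on `Γ_{ℚ(μ_{3^m}, T)}` is principal",
and the N11 instance (n1011-p13, `GaloisImage/SakamotoN11Instance`, p255331) keeps it as the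
explicit binder `hH3`. The inputs that kill such an `H¹` at `p = 3` live in GROUP cohomology of a
finite quotient (x11b3's `X11b/Three/ImageSah`: Sah's lemma, `Sah.isZero_H1_of_eq_neg_one :
IsZero (groupCohomology.H1 A)` from a central element acting as `−1`). This file is the generic
bridge between the two (no curve input); the sequel `GaloisImage/InflationRestrictionSakamotoH3`
discharges `hH3` for `E[3]` from the `3`-adic tower.

## Contents

* §1 (any topological representation `X : TopRep R G`, on the tree's continuous crossed
  homomorphisms `contOneCocycles X` / classes `oneCocycleClass X` of `ContinuousH1`):
  **Sah's lemma modulo a vanishing subgroup.** If `z : G` satisfies `φ [g, z] = 0` and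
  `ρ [g, z] = 1` for all `g` (e.g. `[g, z]` lies in a subgroup on which `φ` and `ρ` are trivial —
  `z` need NOT be central in `G`) and `x ↦ ρ(z) x − x` is bijective, then `φ` is principal:
  `InflRes.exists_eq_sub_of_commutator`, `InflRes.oneCocycleClass_eq_zero_of_commutator`,
  `InflRes.oneCocycleClass_eq_zero_of_vanishing`; the key identity
  `(ρ z − 1) φ(g) = (ρ g − 1) φ(z)` is `InflRes.apply_sub_eq_of_commutator`; the case `ρ(z) = −1`
  on a module killed by an odd integer is `InflRes.bijective_rho_sub_self_of_eq_neg`.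
* §2 **The inflation–restriction bridge to Mathlib's group cohomology of the finite quotient.**
  For `N ⊴ G` acting trivially on `X` (Mathlib `Representation.ofQuotient`):
  `InflRes.exists_eq_sub_of_vanishing_of_cocycles₁_le` — if every `1`-cocycle of the
  `G ⧸ N`-representation is a `1`-coboundary then every continuous crossed homomorphism of `G`
  vanishing on `N` is principal; `InflRes.cocycles₁_le_coboundaries₁_iff_isZero_H1` (Mathlib's
  `H1` vanishes iff `Z¹ ≤ B¹`); `InflRes.oneCocycleClass_eq_zero_of_vanishing_of_isZero_H1`; for
  `N` OPEN the converse `InflRes.cocycles₁_le_coboundaries₁_of_forall` and the equivalence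
  `InflRes.isZero_H1_ofQuotient_iff :
  IsZero (H1 (Rep.of (X.ρ.toRepresentation.ofQuotient N))) ↔ (every continuous crossed
  homomorphism vanishing on N has class 0)` — "finite-quotient group `H¹` = kernel of restriction
  on continuous cocycles".
* §3 **The (H.3) shape of the fact** for discrete Galois modules `ρ` on `M` ("`T`"), `ρbar` on
  `Mbar` ("`T̄`") over a field `K` at level `n` (vanishing subgroup `{u | ρ u = 1} ∩ Gal(K̄/K(μ_n))`,
  which contains all commutators: tree `commutator_le_rootsOfUnityFixer`): `InflRes.h3_of_commute`
  (`ρ z`, `ρbar z` central in the images, `ρbar z − 1` bijective) and `InflRes.h3_of_eq_neg`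
  (`ρ z = −1`, the fact's injective equivariant `incl : Mbar → M`, `Mbar` killed by an odd integer).

References: R. Sakamoto, JTNB 36 (2024) §2 (H.3); J.-P. Serre, *Galois Cohomology* (1997), I.§2.6(b) (inflation–restriction), I.§5.8;
C.-H. Sah, *Automorphisms of finite groups*, J. Algebra 10 (1968) (central element without fixed
points kills `H¹`), cf. S. Lang, *Elliptic Curves: Diophantine Analysis*, and B. Mazur–K. Rubin,
*Kolyvagin systems*, Mem. AMS 799 (2004), proof of Lemma 3.5.2 / hypothesis (H.3).
-/

noncomputable section

open CategoryTheory CategoryTheory.Limits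
open Field groupCohomology
open Literature.NumberTheory.GaloisRepresentations
open scoped ContRepresentation Pointwise

universe u v

namespace Summit.BirchSwinnertonDyer.Rank1Residual.GaloisImage

namespace InflRes

/-! ### §1 Sah's lemma modulo a vanishing subgroup, for continuous crossed homomorphisms -/

section TopRep

variable {R : Type u} [Ring R] [TopologicalSpace R]
variable {G : Type v} [Group G] [TopologicalSpace G] [IsTopologicalGroup G]
variable (X : TopRep.{v} R G)

omit [TopologicalSpace G] [IsTopologicalGroup G] in
/-- If `ρ` kills the commutator `g z g⁻¹ z⁻¹`, then `ρ g` and `ρ z` commute. [folklore] -/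
theorem rho_mul_eq_of_commutator (z g : G) (hρ : X.ρ (g * z * g⁻¹ * z⁻¹) = 1) :
    X.ρ g * X.ρ z = X.ρ z * X.ρ g :=
  calc X.ρ g * X.ρ z = X.ρ (g * z) := (map_mul X.ρ g z).symm
    _ = X.ρ (g * z * g⁻¹ * z⁻¹ * (z * g)) := by congr 1; group
    _ = X.ρ z * X.ρ g := by rw [map_mul, hρ, one_mul, map_mul]

omit [IsTopologicalGroup G] in
/-- **The key identity of Sah's lemma, modulo a vanishing subgroup.** For a continuous crossed
homomorphism `φ` (`φ (g h) = φ g + g • φ h`) and `z, g ∈ G` such that `φ` and `ρ` are trivial on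
the commutator `g z g⁻¹ z⁻¹`: `(ρ z − 1) φ(g) = (ρ g − 1) φ(z)` (compare `φ (g z)` with
`φ ([g,z] · z g)`). Serre, *Galois Cohomology*, I.§5.8; Sah 1968. [folklore] -/
theorem apply_sub_eq_of_commutator (φ : contOneCocycles X) (z g : G)
    (hφ : φ.1 (g * z * g⁻¹ * z⁻¹) = 0) (hρ : X.ρ (g * z * g⁻¹ * z⁻¹) = 1) :
    X.ρ z (φ.1 g) - φ.1 g = X.ρ g (φ.1 z) - φ.1 z := by
  have e : g * z = g * z * g⁻¹ * z⁻¹ * (z * g) := by group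
  have h1 : φ.1 (g * z) = φ.1 g + X.ρ g (φ.1 z) := φ.2 g z
  have h2 : φ.1 (g * z * g⁻¹ * z⁻¹ * (z * g)) = φ.1 z + X.ρ z (φ.1 g) := by
    rw [φ.2 (g * z * g⁻¹ * z⁻¹) (z * g), hφ, zero_add, hρ]
    exact φ.2 z g
  rw [← e, h1] at h2
  rw [sub_eq_sub_iff_add_eq_add, add_comm (X.ρ z (φ.1 g)), add_comm (X.ρ g (φ.1 z))]
  exact h2.symm

omit [IsTopologicalGroup G] in
/-- **Sah's lemma modulo a vanishing subgroup (cocycle form).** Let `φ : G → X` be a continuous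
crossed homomorphism and `z ∈ G` such that, for every `g`, `φ` vanishes at the commutator
`g z g⁻¹ z⁻¹` and `ρ (g z g⁻¹ z⁻¹) = 1` (so `z` is central in `G` MODULO a subgroup on which `φ`
and `ρ` are trivial — `z` itself need not be central), and such that `x ↦ ρ(z) x − x` is
bijective on `X`. Then `φ` is principal: `φ g = ρ(g) v − v` with `v` THE solution of
`ρ(z) v − v = φ z`. (Proof: `(ρ z − 1) φ g = (ρ g − 1) φ z = (ρ g − 1)(ρ z − 1) v
= (ρ z − 1)(ρ g − 1) v` and `ρ z − 1` is injective.) Sah 1968; Lang, *Elliptic Curves: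
Diophantine Analysis*; Mazur–Rubin 2004, proof of Lemma 3.5.2. [folklore] -/
theorem exists_eq_sub_of_commutator (φ : contOneCocycles X) (z : G)
    (hφ : ∀ g, φ.1 (g * z * g⁻¹ * z⁻¹) = 0) (hρ : ∀ g, X.ρ (g * z * g⁻¹ * z⁻¹) = 1)
    (hu : Function.Bijective fun x : X => X.ρ z x - x) :
    ∃ v : X, ∀ g, φ.1 g = X.ρ g v - v := by
  obtain ⟨a, ha⟩ := hu.2 (φ.1 z)
  change X.ρ z a - a = φ.1 z at ha
  refine ⟨a, fun g => hu.1 ?_⟩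
  have hcomm : X.ρ g (X.ρ z a) = X.ρ z (X.ρ g a) := by
    change (X.ρ g * X.ρ z) a = (X.ρ z * X.ρ g) a
    rw [rho_mul_eq_of_commutator X z g (hρ g)]
  change X.ρ z (φ.1 g) - φ.1 g = X.ρ z (X.ρ g a - a) - (X.ρ g a - a)
  rw [apply_sub_eq_of_commutator X φ z g (hφ g) (hρ g), ← ha, map_sub, map_sub, hcomm]
  abel

/-- **Sah's lemma modulo a vanishing subgroup (class form)**: under the hypotheses of
`exists_eq_sub_of_commutator` the class of `φ` in `H¹_cont(G, X)` vanishes. [folklore] -/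
theorem oneCocycleClass_eq_zero_of_commutator (φ : contOneCocycles X) (z : G)
    (hφ : ∀ g, φ.1 (g * z * g⁻¹ * z⁻¹) = 0) (hρ : ∀ g, X.ρ (g * z * g⁻¹ * z⁻¹) = 1)
    (hu : Function.Bijective fun x : X => X.ρ z x - x) :
    oneCocycleClass X φ = 0 :=
  (oneCocycleClass_eq_zero_iff X φ).mpr (exists_eq_sub_of_commutator X φ z hφ hρ hu)

/-- **Subgroup form.** If `φ` vanishes on a subgroup `N`, `N` acts trivially on `X`, some `z` is
central modulo `N` (`g z g⁻¹ z⁻¹ ∈ N` for all `g`) and `x ↦ ρ(z) x − x` is bijective, then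
`[φ] = 0` in `H¹_cont(G, X)`. (For `N ⊴ G` this is: `z N` central in `G ⧸ N` with `ρ(z) − 1`
invertible kills the inflated part `H¹(G ⧸ N, X)` — Sah's lemma for the finite quotient,
transported to continuous cochains without forming the quotient.) [folklore] -/
theorem oneCocycleClass_eq_zero_of_vanishing (N : Subgroup G) (φ : contOneCocycles X)
    (hφN : ∀ n ∈ N, φ.1 n = 0) (hρN : ∀ n ∈ N, X.ρ n = 1) (z : G)
    (hz : ∀ g, g * z * g⁻¹ * z⁻¹ ∈ N) (hu : Function.Bijective fun x : X => X.ρ z x - x) :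
    oneCocycleClass X φ = 0 :=
  oneCocycleClass_eq_zero_of_commutator X φ z (fun g => hφN _ (hz g)) (fun g => hρN _ (hz g)) hu

omit [TopologicalSpace G] [IsTopologicalGroup G] in
/-- **`ρ(z) = −1` on a module killed by an odd integer.** If `ρ(z) x = −x` for all `x` and
`m • x = 0` for an odd `m`, then `x ↦ ρ(z) x − x = −2x` is bijective (inverse
`y ↦ −(m+1)/2 · y`). The `p = 3` situation: `X = E[3]`, `−1` in the image of `ρ̄_{E,3}`. [folklore] -/
theorem bijective_rho_sub_self_of_eq_neg (z : G) (hneg : ∀ x : X, X.ρ z x = -x) (m : ℕ)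
    (hm : Odd m) (htors : ∀ x : X, m • x = 0) :
    Function.Bijective fun x : X => X.ρ z x - x := by
  obtain ⟨j, rfl⟩ := hm
  have key : ∀ x : X, (j + 1) • (x + x) = x := fun x => by
    rw [← two_nsmul, smul_smul, show (j + 1) * 2 = 2 * j + 1 + 1 by ring, succ_nsmul, htors,
      zero_add]
  refine Function.bijective_iff_has_inverse.mpr
    ⟨fun y => -((j + 1) • y), fun x => ?_, fun y => ?_⟩
  · change -((j + 1) • (X.ρ z x - x)) = x
    rw [hneg, show -x - x = -(x + x) by abel, smul_neg, neg_neg, key]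
  · change X.ρ z (-((j + 1) • y)) - -((j + 1) • y) = y
    rw [hneg, neg_neg, sub_neg_eq_add, ← smul_add, key]

end TopRep

/-! ### §2 The bridge to the group cohomology of the finite quotient -/

section Quotient

variable {k H : Type u} [CommRing k] [Group H]

/-- For a representation `A` of a group `H`, Mathlib's `H¹(H, A)` vanishes iff every
`1`-cocycle is a `1`-coboundary. [folklore] -/
theorem cocycles₁_le_coboundaries₁_iff_isZero_H1 (A : Rep k H) :
    cocycles₁ A ≤ coboundaries₁ A ↔ IsZero (groupCohomology.H1 A) := by
  constructor
  · intro hle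
    haveI : Subsingleton (groupCohomology.H1 A) :=
      subsingleton_of_forall_eq 0 fun x =>
        H1_induction_on x fun c => (H1π_eq_zero_iff c).mpr (hle c.2)
    exact ModuleCat.isZero_of_subsingleton _
  · intro h f hf
    haveI := ModuleCat.subsingleton_of_isZero h
    exact (H1π_eq_zero_iff ⟨f, hf⟩).mp (Subsingleton.elim _ _)

variable {R : Type u} [CommRing R] [TopologicalSpace R]
variable {G : Type u} [Group G] [TopologicalSpace G] [IsTopologicalGroup G]
variable (X : TopRep.{u} R G) (N : Subgroup G) [N.Normal]
  [Representation.IsTrivial (X.ρ.toRepresentation.comp N.subtype)]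

omit [IsTopologicalGroup G] in
/-- **Inflation–restriction, the bridge (group cohomology of `G ⧸ N` ⟹ continuous cocycles of
`G`).** Let `N ⊴ G` act trivially on `X`, so that `X` is a representation of `G ⧸ N` (Mathlib
`Representation.ofQuotient`). If every `1`-cocycle of `G ⧸ N` with values in `X` is a
`1`-coboundary (`Z¹ ≤ B¹`, e.g. from `IsZero (H1 _)` — the output of x11b3's Sah files), then every
CONTINUOUS crossed homomorphism `φ : G → X` vanishing on `N` is principal: `φ` is constant on
the cosets of `N`, descends to a `1`-cocycle of `G ⧸ N`, which is `q ↦ q • v − v`.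
Serre, *Galois Cohomology*, I.§2.6(b), I.§5.8. [folklore] -/
theorem exists_eq_sub_of_vanishing_of_cocycles₁_le
    (hH : cocycles₁ (Rep.of (X.ρ.toRepresentation.ofQuotient N)) ≤
      coboundaries₁ (Rep.of (X.ρ.toRepresentation.ofQuotient N)))
    (φ : contOneCocycles X) (hφN : ∀ n ∈ N, φ.1 n = 0) :
    ∃ v : X, ∀ g, φ.1 g = X.ρ g v - v := by
  -- `φ` is constant on the left cosets of `N`
  have hmul : ∀ (g n : G), n ∈ N → φ.1 (g * n) = φ.1 g := fun g n hn => by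
    rw [φ.2 g n, hφN n hn, map_zero, add_zero]
  have hout : ∀ g : G, φ.1 (Quotient.out (g : G ⧸ N)) = φ.1 g := fun g => by
    obtain ⟨n, hn⟩ := QuotientGroup.mk_out_eq_mul N g
    rw [hn, hmul g n n.2]
  -- the descended function `F : G ⧸ N → X` is a `1`-cocycle of the quotient representation
  set F : G ⧸ N → X := fun q => φ.1 (Quotient.out q) with hF
  have hFmk : ∀ g : G, F (g : G ⧸ N) = φ.1 g := fun g => hout g
  have hFmem : F ∈ cocycles₁ (Rep.of (X.ρ.toRepresentation.ofQuotient N)) := by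
    rw [mem_cocycles₁_iff]
    intro q₁ q₂
    induction q₁ using QuotientGroup.induction_on with
    | H g =>
      induction q₂ using QuotientGroup.induction_on with
      | H h =>
        change F ((g : G ⧸ N) * (h : G ⧸ N)) = X.ρ g (F (h : G ⧸ N)) + F (g : G ⧸ N)
        rw [← QuotientGroup.mk_mul, hFmk, hFmk, hFmk, φ.2 g h, add_comm]
  obtain ⟨a, ha⟩ := hH hFmem
  refine ⟨a, fun g => ?_⟩
  have h := congrFun ha (g : G ⧸ N)
  rw [hFmk] at h
  change X.ρ g a - a = φ.1 g at h
  exact h.symm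

/-- **Class form of the bridge**: if `H¹(G ⧸ N, X) = 0` in Mathlib's group cohomology
(`IsZero (groupCohomology.H1 (Rep.of (X.ρ.toRepresentation.ofQuotient N)))`), then every
continuous crossed homomorphism of `G` vanishing on `N` has class `0` in `H¹_cont(G, X)`.
Serre, *Galois Cohomology*, I.§2.6(b). [folklore] -/
theorem oneCocycleClass_eq_zero_of_vanishing_of_isZero_H1
    (hH : IsZero (groupCohomology.H1 (Rep.of (X.ρ.toRepresentation.ofQuotient N))))
    (φ : contOneCocycles X) (hφN : ∀ n ∈ N, φ.1 n = 0) :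
    oneCocycleClass X φ = 0 :=
  (oneCocycleClass_eq_zero_iff X φ).mpr
    (exists_eq_sub_of_vanishing_of_cocycles₁_le X N
      ((cocycles₁_le_coboundaries₁_iff_isZero_H1 _).mpr hH) φ hφN)

/-- **The converse for an OPEN subgroup** (inflation is a bijection on cocycles): if `N` is open
and every continuous crossed homomorphism of `G` vanishing on `N` is principal, then every
`1`-cocycle of `G ⧸ N` with values in `X` is a `1`-coboundary (the inflated function
`g ↦ F (g N)` is constant on the open cosets of `N`, hence continuous, and vanishes on `N`).
Serre, *Galois Cohomology*, I.§2.6(b), I.§5.8. [folklore] -/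
theorem cocycles₁_le_coboundaries₁_of_forall (hNo : IsOpen (N : Set G))
    (h : ∀ φ : contOneCocycles X, (∀ n ∈ N, φ.1 n = 0) → ∃ v : X, ∀ g, φ.1 g = X.ρ g v - v) :
    cocycles₁ (Rep.of (X.ρ.toRepresentation.ofQuotient N)) ≤
      coboundaries₁ (Rep.of (X.ρ.toRepresentation.ofQuotient N)) := by
  intro F hFmem
  have hF := (mem_cocycles₁_iff F).mp hFmem
  have hF1 : F 1 = 0 := cocycles₁_map_one ⟨F, hFmem⟩
  -- the inflated function is locally constant, hence continuous
  have hcont : Continuous fun g : G => F (g : G ⧸ N) := by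
    refine ((IsLocallyConstant.iff_exists_open _).mpr fun g => ?_).continuous
    refine ⟨g • (N : Set G), hNo.smul g, ⟨1, N.one_mem, by simp⟩, ?_⟩
    rintro _ ⟨n, hn, rfl⟩
    change F ((g * n : G) : G ⧸ N) = F (g : G ⧸ N)
    congr 1
    rw [QuotientGroup.eq, mul_inv_rev, inv_mul_cancel_right]
    exact N.inv_mem hn
  -- and is a continuous crossed homomorphism vanishing on `N`
  let φ : contOneCocycles X :=
    ⟨⟨fun g => F (g : G ⧸ N), hcont⟩, fun g g' => by
      have e := hF (g : G ⧸ N) (g' : G ⧸ N)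
      change F ((g : G ⧸ N) * (g' : G ⧸ N)) = X.ρ g (F (g' : G ⧸ N)) + F (g : G ⧸ N) at e
      change F ((g * g' : G) : G ⧸ N) = F (g : G ⧸ N) + X.ρ g (F (g' : G ⧸ N))
      rw [QuotientGroup.mk_mul, e, add_comm]⟩
  obtain ⟨v, hv⟩ := h φ fun n hn => by
    change F (n : G ⧸ N) = 0
    rw [(QuotientGroup.eq_one_iff n).mpr hn, hF1]
  refine ⟨v, funext fun q => QuotientGroup.induction_on q fun g => ?_⟩
  change X.ρ g v - v = F (g : G ⧸ N)
  exact (hv g).symm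

/-- **Inflation–restriction in degree one, as an equivalence** ("`H¹` of the finite quotient =
kernel of restriction on continuous cocycles"): for an OPEN normal subgroup `N` acting trivially
on `X`, Mathlib's group cohomology `H¹(G ⧸ N, X)` vanishes iff every continuous crossed
homomorphism `G → X` vanishing on `N` has class `0` in `H¹_cont(G, X)`.
Serre, *Galois Cohomology*, I.§2.6(b), I.§5.8. [folklore] -/
theorem isZero_H1_ofQuotient_iff (hNo : IsOpen (N : Set G)) :
    IsZero (groupCohomology.H1 (Rep.of (X.ρ.toRepresentation.ofQuotient N))) ↔
      ∀ φ : contOneCocycles X, (∀ n ∈ N, φ.1 n = 0) → oneCocycleClass X φ = 0 := by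
  rw [← cocycles₁_le_coboundaries₁_iff_isZero_H1]
  constructor
  · intro hH φ hφN
    exact (oneCocycleClass_eq_zero_iff X φ).mpr
      (exists_eq_sub_of_vanishing_of_cocycles₁_le X N hH φ hφN)
  · intro h
    exact cocycles₁_le_coboundaries₁_of_forall X N hNo fun φ hφN =>
      (oneCocycleClass_eq_zero_iff X φ).mp (h φ hφN)

end Quotient

/-! ### §3 The (H.3) shape of Sakamoto 2024 for discrete Galois modules -/

section Galois

variable {K : Type u} [Field K]
variable {M : Type u} [AddCommGroup M] [TopologicalSpace M] [DiscreteTopology M]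
variable {Mbar : Type u} [AddCommGroup Mbar] [TopologicalSpace Mbar] [DiscreteTopology Mbar]
variable (ρ : DiscreteGaloisModule K M) (ρbar : DiscreteGaloisModule K Mbar)

/-- Commutators of `Γ_K` fix all `n`-th roots of unity (`K(μ_n)/K` is abelian; the tree's
`commutator_le_rootsOfUnityFixer`). [folklore] -/
theorem commutatorElement_mem_rootsOfUnityFixer (n : ℕ) [NeZero n] [NeZero (n : K)]
    (g z : absoluteGaloisGroup K) : g * z * g⁻¹ * z⁻¹ ∈ rootsOfUnityFixer K n :=
  commutator_le_rootsOfUnityFixer K n (by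
    rw [← commutatorElement_def, commutator_def]
    exact Subgroup.commutator_mem_commutator (Subgroup.mem_top g) (Subgroup.mem_top z))

omit [TopologicalSpace M] [DiscreteTopology M] in
/-- If `ρ z` commutes with every `ρ g` (e.g. `ρ z = −1`), then `ρ` kills every commutator
`g z g⁻¹ z⁻¹`. [folklore] -/
theorem apply_commutator_eq_one_of_commute (π : Representation ℤ (absoluteGaloisGroup K) M)
    (z : absoluteGaloisGroup K) (hz : ∀ g, Commute (π g) (π z)) (g : absoluteGaloisGroup K) :
    π (g * z * g⁻¹ * z⁻¹) = 1 := by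
  rw [map_mul, map_mul, map_mul, (hz g).eq, mul_assoc (π z), ← map_mul π g g⁻¹, mul_inv_cancel,
    map_one, mul_one, ← map_mul, mul_inv_cancel, map_one]

/-- **(H.3) of Sakamoto 2024 from an element central in both images.** Let `ρ` (on `M`, "`T`")
and `ρbar` (on `Mbar`, "`T̄`") be discrete Galois modules over `K`, `n ≥ 1` invertible in `K`,
and `z ∈ Γ_K` such that `ρ z` commutes with all `ρ g`, `ρbar z` commutes with all `ρbar g`, and
`x ↦ ρbar(z) x − x` is bijective on `Mbar`. Then every continuous crossed homomorphism
`f : Γ_K → Mbar` vanishing on `{u | ρ u = 1} ∩ Gal(K̄/K(μ_n))` is principal — the hypothesis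
(H.3) "`H¹(K(μ_n, T)/K, T̄) = 0`" of the tree's fact
`Sakamoto2024.kolyvaginSystems_freeRankOne_zmod_three_pow` in its inflation–restriction form.
(The commutators `[g, z]` lie in that subgroup: `ρ [g,z] = 1` by centrality, and `K(μ_n)/K` is
abelian.) Sakamoto, JTNB 36 (2024) §2 (H.3); Mazur–Rubin 2004, Lemma 3.5.2. [folklore] -/
theorem h3_of_commute (n : ℕ) [NeZero n] [NeZero (n : K)] (z : absoluteGaloisGroup K)
    (hz : ∀ g, Commute (ρ g) (ρ z)) (hzbar : ∀ g, Commute (ρbar g) (ρbar z))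
    (hu : Function.Bijective fun x : Mbar => ρbar z x - x)
    (f : contOneCocycles ρbar.toTopRep)
    (hf : ∀ u : absoluteGaloisGroup K, ρ u = 1 → u ∈ rootsOfUnityFixer K n → f.1 u = 0) :
    oneCocycleClass ρbar.toTopRep f = 0 :=
  oneCocycleClass_eq_zero_of_commutator ρbar.toTopRep f z
    (fun g => hf _ (apply_commutator_eq_one_of_commute ρ.toRepresentation z hz g)
      (commutatorElement_mem_rootsOfUnityFixer n g z))
    (fun g => by
      ext x
      change ρbar.toRepresentation (g * z * g⁻¹ * z⁻¹) x = x
      rw [apply_commutator_eq_one_of_commute ρbar.toRepresentation z hzbar g]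
      rfl)
    hu

/-- **(H.3) of Sakamoto 2024 from `−1` in the image.** Let `ρ` on `M` ("`T`") and `ρbar` on
`Mbar` ("`T̄`") be discrete Galois modules over `K` with an injective equivariant
`incl : Mbar → M` (the fact's `T̄ ↪ T`), `n ≥ 1` invertible in `K`, and suppose `Mbar` is
killed by an odd integer `m` and some `z ∈ Γ_K` acts as `−1` on `M`. Then (H.3) holds at level
`n`: every continuous crossed homomorphism `Γ_K → Mbar` vanishing on
`{u | ρ u = 1} ∩ Gal(K̄/K(μ_n))` is principal. (`z` acts as `−1` on `Mbar` too, `−1` is central,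
and `ρbar(z) − 1 = −2` is invertible on an odd-torsion module — Sah's lemma.)
Sakamoto, JTNB 36 (2024) §2 (H.3); Sah 1968. [folklore] -/
theorem h3_of_eq_neg (n : ℕ) [NeZero n] [NeZero (n : K)] (z : absoluteGaloisGroup K)
    (hneg : ∀ x : M, ρ z x = -x)
    (incl : ρbar.toContRepresentation →ⁱL ρ.toContRepresentation)
    (hincl : Function.Injective incl) (m : ℕ) (hm : Odd m) (htors : ∀ x : Mbar, m • x = 0)
    (f : contOneCocycles ρbar.toTopRep)
    (hf : ∀ u : absoluteGaloisGroup K, ρ u = 1 → u ∈ rootsOfUnityFixer K n → f.1 u = 0) :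
    oneCocycleClass ρbar.toTopRep f = 0 := by
  have hnegbar : ∀ x : Mbar, ρbar z x = -x := fun x => hincl (by
    rw [map_neg]
    have h := ContIntertwiningMap.isIntertwining incl z x
    simp only [ContinuousRep.toContRepresentation_apply_apply, hneg] at h
    exact h)
  have hρz : ρ z = -1 := LinearMap.ext fun x => by rw [hneg]; rfl
  have hρbarz : ρbar z = -1 := LinearMap.ext fun x => by rw [hnegbar]; rfl
  exact h3_of_commute ρ ρbar n z
    (fun g => by rw [hρz]; exact Commute.neg_one_right _)
    (fun g => by rw [hρbarz]; exact Commute.neg_one_right _)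
    (bijective_rho_sub_self_of_eq_neg ρbar.toTopRep z hnegbar m hm htors) f hf

end Galois

end InflRes

end Summit.BirchSwinnertonDyer.Rank1Residual.GaloisImage

end
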